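import Summits.NavierStokesRegularity.NavierStokesRegularity.Theses.SymmetryModuliCount
import Literature.Analysis.FluidPDE.TemperedLinearisedNS
import Literature.Analysis.FluidPDE.KNSSRemark61

/-!
# `LinearLiouvilleSeven` (crux stmt-NavierStokesRegularity-4054, route SymmetryModuliCount):
# normal form and logical position — negative-side support (cdisprove seat, cycle 1)

Sorry-free lemmas of the standing disprover of
`Summit.NavierStokesRegularity.NavierStokesRegularity.Theses.SymmetryModuliCount.LinearLiouvilleSeven`
("about every `u ∈ A_C` — smooth, div-free, KNSS-mild, `|u| ≤ C/√(−t)` on `t < 0` — any seven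
tempered classical solutions of the linearised Navier–Stokes system are dependent modulo slice-wise
constants"), extracted from its work file `Cruxes/LinearLiouvilleSeven/Disproof.lean` so that
ideators, planners and provers can IMPORT them. Companion files in this directory:
`ParasiticModes` (load-bearing: the quotient), `AffineModes` (load-bearing: backward decay),
`LinearLiouvilleSevenFalseOfGalileanNontrivial` (the Galilean collapse `H → ¬ crux`).

* §0 NORMAL FORM: `InClassA`, `SevenTempered`, `DependentModSlice`, `linearLiouvilleSeven_iff`
  (`Iff.rfl`), `sevenTempered_iff` (the per-index hypothesis is verbatim the tree's
  `IsTemperedLinearisedNSSolution`); non-vacuity `inClassA_zero` (`0 ≤ C`), `inClassA_neg_empty`.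
* §1 LOGICAL POSITION: `atZero_of_linearLiouvilleSeven` (the crux contains its `u = 0` instance
  `AtZero`); `not_typeIAncientLiouville_of_not_linearLiouvilleSeven` (with the classical anchor
  `AtZero` standing — tempered ancient Stokes seven-families are dependent mod constants, the lead's
  `stub_anchorOfParts` — a refutation of the crux refutes the route TARGET `X`, i.e. exhibits a
  nonzero Type-I ancient mild solution, which is open); `atZero_of_temperedStokesSliceConstant`.

## References

* G. Koch, N. Nadirashvili, G. Seregin, V. Šverák, Acta Math. 203 (2009), §1 (parasitic solutions
  `b(t)`, `−b′(t)·x`), (1.4), Prop. 4.1, Remark 6.1. [KNSS2009]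
* C. R. Doering, J. D. Gibbon, *Applied Analysis of the Navier–Stokes Equations*, CUP 1995, §9.3
  (9.3.2) (the linearised system). [DoeringGibbon1995]
-/

noncomputable section

open Set Function MeasureTheory InnerProductSpace
open scoped Laplacian ContDiff Topology RealInnerProductSpace BigOperators

set_option linter.dupNamespace false

namespace Summit.NavierStokesRegularity.NavierStokesRegularity.Theorems.LinearLiouvilleSeven.Negative

open Literature.Analysis Literature.Analysis.FluidPDE
open Summit.NavierStokesRegularity.NavierStokesRegularity.Theses.SymmetryModuliCount

/-- `ℝ³`. -/
abbrev E3 := EuclideanSpace ℝ (Fin 3)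

/-- Membership in the class `A_C` — verbatim the hypothesis block of the crux. -/
def InClassA (C : ℝ) (u : ℝ → E3 → E3) : Prop :=
  ContDiffOn ℝ (⊤ : ℕ∞) (Function.uncurry u) (Set.Iio 0 ×ˢ Set.univ) ∧
  (∀ t < 0, VectorCalculus.IsDivFree (u t)) ∧
  (∀ s t : ℝ, s < t → t < 0 → ∀ x, u t x = heatFlow (u s) (t - s) x -
    ∫ τ in Set.Ioo s t, ∫ y, oseenKernel (t - τ) (x - y) (u τ y) (u τ y)) ∧
  HasTypeITimeDecay C u

/-- The seven-family hypothesis of the crux — verbatim. -/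
def SevenTempered (u : ℝ → E3 → E3) (v : Fin 7 → ℝ → E3 → E3) (q : Fin 7 → ℝ → E3 → ℝ) : Prop :=
  ∀ i, (ContDiffOn ℝ (⊤ : ℕ∞) (Function.uncurry (v i)) (Set.Iio 0 ×ˢ Set.univ) ∧
    ContDiffOn ℝ (⊤ : ℕ∞) (Function.uncurry (q i)) (Set.Iio 0 ×ˢ Set.univ) ∧
    (∃ K : ℝ, ∀ t < 0, ∀ x, ‖(v i) t x‖ ≤ K / Real.sqrt (-t) + K * (1 + ‖x‖) / (-t) ∧
      |(q i) t x| ≤ K / (-t) + K * (1 + ‖x‖) / Real.sqrt (-t) ^ 3) ∧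
    (∀ t < 0, VectorCalculus.IsDivFree ((v i) t)) ∧
    (∀ t < 0, ∀ x, timeDeriv (v i) t x + convect (u t) ((v i) t) x + convect ((v i) t) (u t) x =
      Laplacian.laplacian ((v i) t) x - gradient ((q i) t) x))

/-- The conclusion of the crux: dependence modulo slice-wise constants. -/
def DependentModSlice (v : Fin 7 → ℝ → E3 → E3) : Prop :=
  ∃ c : Fin 7 → ℝ, c ≠ 0 ∧ ∀ t < 0, ∃ b : E3, ∀ x, ∑ i, c i • v i t x = b

/-- The crux, unbundled (`Iff.rfl`): every lemma of this file speaks about the route decl itself. -/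
theorem linearLiouvilleSeven_iff :
    LinearLiouvilleSeven ↔ ∀ C u, InClassA C u → ∀ v q, SevenTempered u v q → DependentModSlice v :=
  Iff.rfl

/-- The per-index hypothesis of the crux is verbatim the tree's `IsTemperedLinearisedNSSolution`. -/
theorem sevenTempered_iff (u : ℝ → E3 → E3) (v : Fin 7 → ℝ → E3 → E3) (q : Fin 7 → ℝ → E3 → ℝ) :
    SevenTempered u v q ↔ ∀ i, IsTemperedLinearisedNSSolution u (v i) (q i) := by
  refine forall_congr' fun i => ?_
  rw [isTemperedLinearisedNSSolution_iff]

/-! ## Non-vacuity: `0 ∈ A_C` for `0 ≤ C`, and `A_C = ∅` for `C < 0` -/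

/-- `e^{τΔ} 0 = 0` (for `τ ≤ 0` by the junk convention, for `τ > 0` as a Bochner integral of `0`). -/
theorem heatFlow_zero_field (τ : ℝ) : heatFlow (0 : E3 → E3) τ = 0 := by
  unfold heatFlow
  split_ifs with h
  · funext x
    rw [UnboundedOperators.heatExtension_apply]
    simp
  · rfl

/-- **Non-vacuity.** The zero field lies in `A_C` for every `0 ≤ C`. -/
theorem inClassA_zero {C : ℝ} (hC : 0 ≤ C) : InClassA C 0 := by
  refine ⟨contDiffOn_const, ?_, ?_, ?_⟩
  · intro t _ x
    simp [VectorCalculus.divergence]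
  · intro s t _ _ x
    have h0 : (0 : ℝ → E3 → E3) s = 0 := rfl
    simp [heatFlow_zero_field, oseenKernel]
  · intro t ht x
    have : 0 < Real.sqrt (-t) := Real.sqrt_pos.2 (by linarith)
    simp only [Pi.zero_apply, norm_zero]
    positivity

/-- `A_C = ∅` for `C < 0` (the Type-I bound at any point forces `0 ≤ C`). -/
theorem inClassA_neg_empty {C : ℝ} (hC : C < 0) (u : ℝ → E3 → E3) : ¬ InClassA C u := by
  rintro ⟨-, -, -, hT⟩
  have h := hT (-1) (by norm_num) 0
  have : C / Real.sqrt (-(-1 : ℝ)) < 0 := by simp [hC]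
  linarith [norm_nonneg (u (-1) 0)]

/-! ## The crux at the trivial background `u = 0` -/

/-- `LinearLiouvilleSeven` specialised to `u = 0`: tempered ancient STOKES seven-families are
dependent modulo slice-constants. -/
def AtZero : Prop :=
  ∀ (v : Fin 7 → ℝ → E3 → E3) (q : Fin 7 → ℝ → E3 → ℝ),
    (∀ i, IsTemperedLinearisedNSSolution (0 : ℝ → E3 → E3) (v i) (q i)) → DependentModSlice v

/-- The crux contains its `u = 0` instance (take `C = 0`, `u = 0`). -/
theorem atZero_of_linearLiouvilleSeven (h : LinearLiouvilleSeven) : AtZero := by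
  intro v q hvq
  exact (linearLiouvilleSeven_iff.1 h) 0 0 (inClassA_zero le_rfl) v q ((sevenTempered_iff 0 v q).2 hvq)

/-- If `u(t, ·) = 0` then the linearised momentum operator about `u` at time `t` is the Stokes
operator. -/
theorem convect_congr_of_slice_zero {u : ℝ → E3 → E3} {t : ℝ} (hu : ∀ x, u t x = 0)
    (w : E3 → E3) (x : E3) :
    convect (u t) w x + convect w (u t) x =
      convect ((0 : ℝ → E3 → E3) t) w x + convect w ((0 : ℝ → E3 → E3) t) x := by
  have h : u t = 0 := funext hu
  simp [convect, h]

/-- Seven tempered linearised solutions about a field vanishing on `t < 0` are tempered STOKES solutions. -/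
theorem sevenTempered_zero_of_slice_zero {u : ℝ → E3 → E3} (hu : ∀ t < 0, ∀ x, u t x = 0)
    {v : Fin 7 → ℝ → E3 → E3} {q : Fin 7 → ℝ → E3 → ℝ} (h : SevenTempered u v q) :
    SevenTempered 0 v q := by
  intro i
  obtain ⟨h1, h2, h3, h4, h5⟩ := h i
  refine ⟨h1, h2, h3, h4, fun t ht x => ?_⟩
  have := h5 t ht x
  rw [add_assoc, convect_congr_of_slice_zero (hu t ht)] at this
  rwa [add_assoc]

/-- **Any disproof of the crux that leaves the classical `u = 0` anchor standing refutes the route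
target `X = TypeIAncientLiouville`** (a nonzero Type-I ancient mild solution must be produced):
under `X` every `u ∈ A_C` vanishes on `t < 0`, so the linearised operator about `u` is the Stokes
operator there and the crux reduces to its `u = 0` instance. -/
theorem not_typeIAncientLiouville_of_not_linearLiouvilleSeven (h0 : AtZero)
    (h : ¬ LinearLiouvilleSeven) : ¬ TypeIAncientLiouville := by
  intro hX
  apply h
  rw [linearLiouvilleSeven_iff]
  intro C u hu v q hvq
  have hz : ∀ t < 0, ∀ x, u t x = 0 := hX C u hu
  exact h0 v q ((sevenTempered_iff 0 v q).1 (sevenTempered_zero_of_slice_zero hz hvq))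

/-- The single-solution anchor (the lead's `stub_temperedStokesLiouville`, linearised form):
every tempered ancient Stokes solution is slice-wise constant. -/
def TemperedStokesSliceConstant : Prop :=
  ∀ (v : ℝ → E3 → E3) (q : ℝ → E3 → ℝ), IsTemperedLinearisedNSSolution (0 : ℝ → E3 → E3) v q →
    ∀ t < 0, ∃ b : E3, ∀ x, v t x = b

/-- The single-solution anchor implies the `u = 0` instance of the crux (take `c = e₀`). -/
theorem atZero_of_temperedStokesSliceConstant (h : TemperedStokesSliceConstant) : AtZero := by
  intro v q hvq
  refine ⟨Pi.single 0 1, ?_, fun t ht => ?_⟩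
  · intro h0
    have := congrFun h0 0
    simp at this
  · obtain ⟨b, hb⟩ := h (v 0) (q 0) (hvq 0) t ht
    refine ⟨b, fun x => ?_⟩
    simp [Pi.single_apply, hb x]




/-- `d/ds (a − s)⁻¹ = (a − s)⁻²` away from `s = a`. -/
theorem hasDerivAt_inv_sub {a t : ℝ} (h : a - t ≠ 0) :
    HasDerivAt (fun s : ℝ => (a - s)⁻¹) ((a - t)⁻¹ ^ 2) t := by
  have h1 : HasDerivAt (fun s : ℝ => a - s) (-1) t := (hasDerivAt_id' t).const_sub a
  have h2 : HasDerivAt (fun s : ℝ => (a - s)⁻¹) (-((a - t) ^ 2)⁻¹ * -1) t :=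
    (hasDerivAt_inv h).comp t h1
  convert h2 using 1
  rw [inv_pow]
  ring


end Summit.NavierStokesRegularity.NavierStokesRegularity.Theorems.LinearLiouvilleSeven.Negative

end
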